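import Summits.ValiantsHypothesis.ValiantsHypothesis.Theorems.NewtonUnitEquationsTwoProductsExpBlockTensor

/-!
# K10 `exp-block-tensorisation` — L3 PROVED: `expTensorFrames_holds : ExpTensorFrames` (the packaging lemma)

K10b of val-idea-crit-8 g2's queue (20:38:11Z): the exponential block tensor `𝒲 = expTensor blk u v` IS a sum of `2m` products of one factor per
block with factors supported on the block frames (the `v`-sign carried on the factor of the block of the letter `0`), the block frames of a
`BlockGraded` alphabet are DISSOCIATED (a block tuple is recovered from its sum: represent each frame point by a multiset of `≤ m` letters of its
block and apply `BlockGraded` to the two total multisets), and `#blockFrame B ≤ (m+1)^{#A_B}` (a frame point is `Σ_e n_e • e` for a multiplicity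
vector `n : A_B → {0,…,m}`).  Tool: `mem_support_pow_sum_monomial_iff` — the support of `(Σ_{e∈S} X^e)^r` is EXACTLY the set of `r`-fold sums
(its coefficients are tuple counts, non-zero in characteristic `0`).
Helper mode (`--supports stmt-ValiantsHypothesis-5906 --as helper`).  Honest framing: L3 is bookkeeping; the quasi-polynomial corollary
`BlockGradedQuasiPoly` still waits for L2 `ExpTensorVisible` (K10c); nothing here closes 5906 or 5905; VP ≠ VNP is NOT proved.  No instances,
no notation, no named facts. [folklore]
-/

noncomputable section
set_option linter.dupNamespace false

namespace Summit.ValiantsHypothesis.ValiantsHypothesis.Theorems.NewtonUnitEquations.TwoProducts.ExpBlock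

open MvPolynomial Finset
open Summit.ValiantsHypothesis.ValiantsHypothesis.Theorems.NewtonUnitEquations.TwoProducts.FormalLogLinearisation
open Summit.ValiantsHypothesis.ValiantsHypothesis.Theorems.NewtonUnitEquations.TwoProducts.PlanarCell

variable {m b : ℕ}

/-! ## Supports of powers -/

/-- The power `(Σ_{e∈S} X^e)^r` expanded over ordered `r`-tuples. [folklore] -/
theorem pow_sum_monomial_eq (S : Finset Expo) (r : ℕ) :
    (∑ e ∈ S, (monomial e (1 : ℂ) : MvPolynomial (Fin 2) ℂ)) ^ r =
      ∑ g ∈ Fintype.piFinset (fun _ : Fin r => S), monomial (∑ i, g i) (1 : ℂ) := by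
  classical
  rw [show (∑ e ∈ S, (monomial e (1 : ℂ) : MvPolynomial (Fin 2) ℂ)) ^ r =
      ∏ _i : Fin r, (∑ e ∈ S, (monomial e (1 : ℂ) : MvPolynomial (Fin 2) ℂ)) by simp, Finset.prod_univ_sum]
  refine Finset.sum_congr rfl fun g _ => ?_
  rw [show (monomial (∑ i, g i)) (1 : ℂ) = (monomial (∑ i, g i) (∏ _i : Fin r, (1 : ℂ)) : MvPolynomial (Fin 2) ℂ) by simp,
    monomial_sum_prod]

/-- The coefficient of `(Σ_{e∈S} X^e)^r` at `p` is the NUMBER of ordered `r`-tuples from `S` with sum `p`. [folklore] -/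
theorem coeff_pow_sum_monomial (S : Finset Expo) (r : ℕ) (p : Expo) :
    coeff p ((∑ e ∈ S, (monomial e (1 : ℂ) : MvPolynomial (Fin 2) ℂ)) ^ r) =
      (((Fintype.piFinset (fun _ : Fin r => S)).filter (fun g => ∑ i, g i = p)).card : ℂ) := by
  classical
  rw [pow_sum_monomial_eq, coeff_sum]
  simp only [coeff_monomial]
  rw [Finset.sum_boole]

/-- **The support of `(Σ_{e∈S} X^e)^r` is exactly the set of `r`-fold sums from `S`** (characteristic `0`). [folklore] -/
theorem mem_support_pow_sum_monomial_iff (S : Finset Expo) (r : ℕ) (p : Expo) :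
    p ∈ ((∑ e ∈ S, (monomial e (1 : ℂ) : MvPolynomial (Fin 2) ℂ)) ^ r).support ↔
      ∃ g : Fin r → Expo, (∀ i, g i ∈ S) ∧ ∑ i, g i = p := by
  classical
  rw [mem_support_iff, coeff_pow_sum_monomial, Nat.cast_ne_zero, ← Nat.pos_iff_ne_zero, Finset.card_pos]
  constructor
  · rintro ⟨g, hg⟩
    rw [Finset.mem_filter, Fintype.mem_piFinset] at hg
    exact ⟨g, hg.1, hg.2⟩
  · rintro ⟨g, hgS, hgp⟩
    exact ⟨g, Finset.mem_filter.2 ⟨Fintype.mem_piFinset.2 hgS, hgp⟩⟩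

/-- The support of a power lies in the tuple sums of the support. [folklore] -/
theorem mem_support_pow (q : MvPolynomial (Fin 2) ℂ) (r : ℕ) (p : Expo) (hp : p ∈ (q ^ r).support) :
    ∃ g : Fin r → Expo, (∀ i, g i ∈ q.support) ∧ ∑ i, g i = p := by
  classical
  induction r generalizing p with
  | zero =>
    rw [pow_zero] at hp
    have : p = 0 := by
      have h := support_one (R := ℂ) (σ := Fin 2) ▸ hp
      simpa using h
    exact ⟨Fin.elim0, fun i => Fin.elim0 i, by simp [this]⟩
  | succ r ih =>
    rw [pow_succ] at hp
    obtain ⟨x, hx, y, hy, rfl⟩ := Finset.mem_add.1 (support_mul _ _ hp)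
    obtain ⟨g, hg, hgx⟩ := ih x hx
    refine ⟨Fin.snoc g y, fun i => ?_, ?_⟩
    · refine Fin.lastCases ?_ (fun i => ?_) i
      · simpa using hy
      · simpa using hg i
    · rw [Fin.sum_univ_castSucc]
      simp [hgx]

/-- Membership in a block frame: a sum of at most `m` letters of the block. [folklore] -/
theorem mem_blockFrame_iff (A : Finset Expo) (blk : Expo → Fin b) (m : ℕ) (B : Fin b) (p : Expo) :
    p ∈ blockFrame A blk m B ↔ ∃ r, r ≤ m ∧ ∃ g : Fin r → Expo, (∀ i, g i ∈ A.filter (fun e => blk e = B)) ∧ ∑ i, g i = p := by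
  classical
  unfold blockFrame
  rw [Finset.mem_biUnion]
  constructor
  · rintro ⟨r, hr, hp⟩
    obtain ⟨g, hg, hgp⟩ := (mem_support_pow_sum_monomial_iff _ r p).1 hp
    exact ⟨r, by simpa [Nat.lt_succ_iff] using hr, g, hg, hgp⟩
  · rintro ⟨r, hr, g, hg, hgp⟩
    exact ⟨r, Finset.mem_range.2 (Nat.lt_succ_of_le hr), (mem_support_pow_sum_monomial_iff _ r p).2 ⟨g, hg, hgp⟩⟩

/-! ## The factors and their supports -/

/-- The support of the block restriction lies in the block part of any letter set containing the support. [folklore] -/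
theorem support_restrictBlock_subset (blk : Expo → Fin b) (B : Fin b) (q : MvPolynomial (Fin 2) ℂ) (A : Finset Expo)
    (hq : q.support ⊆ A) : (restrictBlock blk B q).support ⊆ A.filter (fun e => blk e = B) := by
  classical
  intro x hx
  unfold restrictBlock at hx
  obtain ⟨e, he, hxe⟩ := Finset.mem_biUnion.1 (support_sum hx)
  have hx' : x = e := by
    have := support_monomial_subset hxe
    simpa using this
  subst hx'
  exact Finset.mem_filter.2 ⟨hq (Finset.mem_filter.1 he).1, (Finset.mem_filter.1 he).2⟩

/-- The support of a truncated exponential of a polynomial supported in the block lies in the block frame. [folklore] -/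
theorem support_truncExp_subset (A : Finset Expo) (blk : Expo → Fin b) (m : ℕ) (B : Fin b) (q : MvPolynomial (Fin 2) ℂ)
    (hq : q.support ⊆ A.filter (fun e => blk e = B)) : (truncExp m q).support ⊆ blockFrame A blk m B := by
  classical
  intro p hp
  unfold truncExp at hp
  obtain ⟨r, hr, hpr⟩ := Finset.mem_biUnion.1 (support_sum hp)
  have hpr' : p ∈ (q ^ r).support := support_smul hpr
  obtain ⟨g, hg, hgp⟩ := mem_support_pow q r p hpr'
  exact (mem_blockFrame_iff A blk m B p).2 ⟨r, by simpa [Nat.lt_succ_iff] using hr, g, fun i => hq (hg i), hgp⟩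

/-- A product with the sign flipped on exactly one factor. [folklore] -/
theorem prod_ite_neg {ι : Type*} [Fintype ι] [DecidableEq ι] (i₀ : ι) (g : ι → MvPolynomial (Fin 2) ℂ) :
    ∏ i, (if i = i₀ then - g i else g i) = - ∏ i, g i := by
  have h : ∀ i, (if i = i₀ then - g i else g i) = (if i = i₀ then (-1 : MvPolynomial (Fin 2) ℂ) else 1) * g i := by
    intro i; split_ifs <;> simp
  simp_rw [h]
  rw [Finset.prod_mul_distrib, Finset.prod_ite_eq']
  simp

/-! ## Block tuples and representing multisets -/

/-- Multiset sums commute with finite sums of multisets. [folklore] -/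
theorem multiset_sum_finset_sum {ι : Type*} (s : Finset ι) (M : ι → Multiset Expo) :
    (∑ i ∈ s, M i).sum = ∑ i ∈ s, (M i).sum := by
  classical
  induction s using Finset.induction_on with
  | empty => simp
  | insert a s ha ih => rw [Finset.sum_insert ha, Finset.sum_insert ha, Multiset.sum_add, ih]

/-- Filtering commutes with finite sums of multisets. [folklore] -/
theorem multiset_filter_finset_sum {ι : Type*} (s : Finset ι) (M : ι → Multiset Expo) (p : Expo → Prop) [DecidablePred p] :
    (∑ i ∈ s, M i).filter p = ∑ i ∈ s, (M i).filter p := by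
  classical
  induction s using Finset.induction_on with
  | empty => simp
  | insert a s ha ih => rw [Finset.sum_insert ha, Finset.sum_insert ha, Multiset.filter_add, ih]

/-- A block tuple of frame points is represented by ONE multiset of letters with at most `m` letters per block, whose block parts sum to
the components. [folklore] -/
theorem exists_multiset_of_blockTuple (A : Finset Expo) (blk : Expo → Fin b) (m : ℕ) (d : Fin b → Expo)
    (hd : ∀ B, d B ∈ blockFrame A blk m B) :
    ∃ k : Multiset Expo, (∀ e ∈ k, e ∈ A) ∧ (∀ B, Multiset.card (k.filter (fun e => blk e = B)) ≤ m) ∧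
      (∀ B, (k.filter (fun e => blk e = B)).sum = d B) ∧ k.sum = ∑ B, d B := by
  classical
  have hd' := fun B => (mem_blockFrame_iff A blk m B (d B)).1 (hd B)
  choose r hr g hg hgd using hd'
  set M : Fin b → Multiset Expo := fun B => (Finset.univ : Finset (Fin (r B))).val.map (g B) with hM
  have hfil : ∀ B, (∑ B', M B').filter (fun e => blk e = B) = M B := by
    intro B
    rw [multiset_filter_finset_sum, Finset.sum_eq_single B]
    · rw [Multiset.filter_eq_self]
      intro e he
      obtain ⟨i, -, rfl⟩ := Multiset.mem_map.1 he
      exact (Finset.mem_filter.1 (hg B i)).2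
    · intro B' _ hne
      rw [Multiset.filter_eq_nil]
      intro e he
      obtain ⟨i, -, rfl⟩ := Multiset.mem_map.1 he
      intro h
      exact hne ((Finset.mem_filter.1 (hg B' i)).2.symm.trans h)
    · intro h
      exact absurd (Finset.mem_univ B) h
  have hMsum : ∀ B, (M B).sum = d B := by
    intro B
    rw [hM]
    simp only
    rw [← Finset.sum_eq_multiset_sum, hgd]
  refine ⟨∑ B, M B, ?_, ?_, ?_, ?_⟩
  · intro e he
    obtain ⟨B, -, heB⟩ := Multiset.mem_sum.1 he
    obtain ⟨i, -, rfl⟩ := Multiset.mem_map.1 heB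
    exact (Finset.mem_filter.1 (hg B i)).1
  · intro B
    rw [hfil B, hM]
    simp only [Multiset.card_map, Finset.card_val, Finset.card_univ, Fintype.card_fin]
    exact hr B
  · intro B
    rw [hfil B, hMsum]
  · rw [multiset_sum_finset_sum]
    exact Finset.sum_congr rfl fun B _ => hMsum B

/-- A frame point is `Σ_e n_e • e` for a multiplicity vector `n : A_B → {0, …, m}`. [folklore] -/
theorem blockFrame_subset_image (A : Finset Expo) (blk : Expo → Fin b) (m : ℕ) (B : Fin b) :
    blockFrame A blk m B ⊆ (Fintype.piFinset fun _ : ↥(A.filter (fun e => blk e = B)) => Finset.range (m + 1)).image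
      (fun n => ∑ e : ↥(A.filter (fun e => blk e = B)), n e • (e : Expo)) := by
  classical
  intro p hp
  obtain ⟨r, hr, g, hg, hgp⟩ := (mem_blockFrame_iff A blk m B p).1 hp
  set AB := A.filter (fun e => blk e = B) with hAB
  refine Finset.mem_image.2 ⟨fun e => (Finset.univ.filter fun i => g i = (e : Expo)).card, ?_, ?_⟩
  · refine Fintype.mem_piFinset.2 fun e => Finset.mem_range.2 (Nat.lt_succ_of_le ?_)
    calc (Finset.univ.filter fun i => g i = (e : Expo)).card ≤ (Finset.univ : Finset (Fin r)).card := Finset.card_filter_le _ _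
      _ = r := by simp
      _ ≤ m := hr
  · -- `Σ_e #{i : g i = e} • e = Σ_i g i`
    rw [← hgp]
    have h1 : ∑ i, g i = ∑ e ∈ Finset.univ.image g, (Finset.univ.filter fun i => g i = e).card • e :=
      Finset.sum_comp (fun x : Expo => x) g
    have h2 : ∑ e ∈ Finset.univ.image g, (Finset.univ.filter fun i => g i = e).card • e =
        ∑ e ∈ AB, (Finset.univ.filter fun i => g i = e).card • e := by
      refine Finset.sum_subset (fun e he => ?_) (fun e _ hne => ?_)
      · obtain ⟨i, -, rfl⟩ := Finset.mem_image.1 he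
        exact hg i
      · have : (Finset.univ.filter fun i => g i = e) = ∅ := by
          rw [Finset.filter_eq_empty_iff]
          intro i _ hi
          exact hne (Finset.mem_image.2 ⟨i, Finset.mem_univ _, hi⟩)
        rw [this, Finset.card_empty, zero_smul]
    rw [h1, h2]
    exact (Finset.sum_coe_sort AB (fun e => (Finset.univ.filter fun i => g i = e).card • e))

/-! ## The packaging lemma -/

/-- **K10 L3 — `expTensorFrames_holds : ExpTensorFrames`** (val-idea-37 g2's L3, text in `…ExpBlockTensor`). [folklore] -/
theorem expTensorFrames_holds : ExpTensorFrames := by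
  intro m b u v A blk hu hv hG
  classical
  -- there is at least one block (the block of the letter `0`)
  set B₀ : Fin b := blk 0 with hB₀
  have hAB : ∀ w : Fin m → MvPolynomial (Fin 2) ℂ, (∀ j, (w j).support ⊆ A) → ∀ j B,
      (truncExp m (restrictBlock blk B (w j))).support ⊆ blockFrame A blk m B := fun w hw j B =>
    support_truncExp_subset A blk m B _ (support_restrictBlock_subset blk B (w j) A (hw j))
  refine ⟨?_, ?_, ?_⟩
  · -- (i) the representation
    let fu : Fin m → Fin b → MvPolynomial (Fin 2) ℂ := fun j B => truncExp m (restrictBlock blk B (u j))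
    let fv : Fin m → Fin b → MvPolynomial (Fin 2) ℂ := fun j B =>
      if B = B₀ then - truncExp m (restrictBlock blk B (v j)) else truncExp m (restrictBlock blk B (v j))
    refine ⟨fun i => Fin.addCases fu fv i, ?_, ?_⟩
    · rw [Fin.sum_univ_add]
      simp only [Fin.addCases_left, Fin.addCases_right]
      unfold expTensor
      rw [sub_eq_add_neg, ← Finset.sum_neg_distrib]
      congr 1
      refine Finset.sum_congr rfl fun j _ => ?_
      exact prod_ite_neg B₀ _
    · intro i B
      refine Fin.addCases (fun j => ?_) (fun j => ?_) i
      · simp only [Fin.addCases_left]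
        exact hAB u (fun j => (hu j).2) j B
      · simp only [Fin.addCases_right]
        show (fv j B).support ⊆ _
        simp only [fv]
        split_ifs
        · rw [support_neg]; exact hAB v (fun j => (hv j).2) j B
        · exact hAB v (fun j => (hv j).2) j B
  · -- (ii) dissociation of the block frames
    intro a c ha hc hsum
    obtain ⟨k, hkA, hkm, hkB, hks⟩ := exists_multiset_of_blockTuple A blk m a ha
    obtain ⟨k', hk'A, -, hk'B, hk's⟩ := exists_multiset_of_blockTuple A blk m c hc
    have h := hG k k' hkA hk'A hkm (by rw [hks, hk's, hsum])
    funext B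
    rw [← hkB B, ← hk'B B]
    exact (h B).1
  · -- (iii) the size of a block frame
    intro B
    calc (blockFrame A blk m B).card
        ≤ ((Fintype.piFinset fun _ : ↥(A.filter (fun e => blk e = B)) => Finset.range (m + 1)).image
            (fun n => ∑ e : ↥(A.filter (fun e => blk e = B)), n e • (e : Expo))).card :=
          Finset.card_le_card (blockFrame_subset_image A blk m B)
      _ ≤ (Fintype.piFinset fun _ : ↥(A.filter (fun e => blk e = B)) => Finset.range (m + 1)).card := Finset.card_image_le
      _ = (m + 1) ^ (A.filter (fun e => blk e = B)).card := by
          rw [Fintype.card_piFinset, Finset.prod_const, Finset.card_range, Finset.card_univ, Fintype.card_coe]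

end Summit.ValiantsHypothesis.ValiantsHypothesis.Theorems.NewtonUnitEquations.TwoProducts.ExpBlock

end
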